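import Summits.QuantumFields.YangMills.Theorems.SwapVirialDeficitGnomonicSpeedLeaders
import Summits.QuantumFields.YangMills.Theorems.SwapVirialDeficitGnomonicDeficitSpeed
import Summits.QuantumFields.YangMills.Theorems.SwapVirialDeficitBlowUpRingPaths
import HarnessLib

/-!
# The SPEED of the σ-glued deficit along the gnomonic blow-up (brick S-B, part 3b — the constant `C_L = 324·L⁴` of fcl-p3 g45's virial SPEC)
# (free-hands support of ⟨stmt-QuantumFields-24197⟩ `SwapVirialDeficit.SwapGluedStiffness`)

The last brick of S-B.  Parts 1–2 (✓`…GnomonicSpeed`, ✓`…GnomonicSpeedLeaders`) bound the LETTER speeds along `s ↦ blowUpPoint (e^s) (gnomonicPoint a ε η)`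
(followers `≤ 1/2`, leaders `≤ 1`), part 3a (✓`…GnomonicDeficitSpeed`) bounds `|d/ds qDeficit|` by `108·M·L⁴` for any moving quaternion history with links of
norm `≤ 1` and speed `≤ M`.  Here the two are joined through the WORD structure of the rebuilt ring (the quantitative twin of ✓`BlowUpRing.contDiff_quatHistory_ringConfig`):

* §1 (generic letter families `C s : Fin 4 → SU2`, `U s : Fol L → SU2` with `su2Quat`-speeds `≤ 1`): `speed_letter` (`≤ 1`), ★ `speed_ringConfig_fst` (slice `0`:
  `letter·U`, `≤ 2`), ★ `speed_glue_ringConfig` (`≤ 2`), ★ `speed_ringConfig_snd_fst` (slices: `glue·U`, `≤ 3`), ★ `speed_ringConfig_snd_snd` (seam: `χ·c·U`,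
  `≤ 2`), ★★ `speed_fixHistory` — EVERY link ∕ site quaternion of `fixHistory (ringConfig χ (C s, U s))` has speed `≤ 3` (✓`Gnomonic.exists_hasDerivAt_mul_norm_le`,
  ✓`norm_su2Quat`, ✓`su2Quat_mul`, the apply-lemmas of ✓`…BlowUpRingChart` ∕ ✓`…BlowUpRingPaths`);
* §2 ★★★ `hasDerivAt_chartDeficit_gnomonic_le` — S-B ITSELF: for hub `a ≠ 0`, signs `ε`, coordinates `η`, sector `z`, character `χ`, every `s`,
  `∃ d, HasDerivAt (fun s => chartDeficit L z χ (blowUpPoint (e^s) (gnomonicPoint a ε η))) d s ∧ |d| ≤ 324·L⁴`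
  (✓`hasDerivAt_leader_speed_le`, ✓`hasDerivAt_smulLetter` + ✓`dilateIm_gnoLetter`, `speed_fixHistory`, ✓`hasDerivAt_qDeficit_le` at `M = 3`,
  ✓`swapRingDeficit_eq_qDeficit`) — hypothesis `hB₂`-type input (`|X F̂| ≤ C_L`, `C_L = 324·L⁴` explicit and polynomial in `L`) of the Euler-field IBP
  ✓`Virial.integral_euler_deriv_mul_eq` ∕ ✓`Gnomonic.integral_flowDeriv_mul_piWeight` for the virial assembly (V2′).

HONEST LABEL: calculus bookkeeping for the window programme of a DRAFT line; an explicit derivative bound, no estimate on ⟨24197⟩ (window-uniform, OPEN);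
⟨24194⟩ ∕ ⟨24497⟩ OPEN; own crux ⟨22884⟩ OPEN (blocked-on ⟨19935⟩); no crux, rung of record or summit is proved; the Yang–Mills mass gap is NOT proved; no
summit is proved by a line.  THEOREMS ONLY (0 `def`, 0 `sorry`), standard axioms.  Width seat ym-line-sfw-p2-w2 g57 (cell ym-idea-1, free hands),
`--supports stmt-QuantumFields-24197`.  References: [cite: Luscher1983, §2]; [folklore].
-/

set_option autoImplicit false

noncomputable section

open Quaternion
open scoped Quaternion BigOperators
open Literature.MathematicalPhysics.QuantumLattice
open Literature.MathematicalPhysics.QuantumFieldTheory hiding SU2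
open Summit.QuantumFields.YangMills.Theorems.FemtoTransferGap
open Summit.QuantumFields.YangMills.Theorems.FemtoTransferGap.TT
open Summit.QuantumFields.YangMills.Theorems.SwapTwistDeficit.ToronLog (axisPoint)
open Summit.QuantumFields.YangMills.Theorems.SwapVirialDeficit.ZeroModeSigma (dil3 dil3_apply)
open Summit.QuantumFields.YangMills.Theorems.SwapVirialDeficit.BlowUp (leaderTuple qDeficit swapRingDeficit_eq_qDeficit)
open Summit.QuantumFields.YangMills.Theorems.SwapVirialDeficit.BlowUpRing

namespace Summit.QuantumFields.YangMills.Theorems.SwapVirialDeficit.Gnomonic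

variable {L : ℕ} [NeZero L]

/-! ## §1 Words: every link ∕ site quaternion of the rebuilt ring moves at speed `≤ 3` when the letters move at speed `≤ 1` -/

section Words

variable {C : ℝ → Fin 4 → SU2} {U : ℝ → Fol L → SU2} {s : ℝ}

/-- A constant letter has speed `0 ≤ a`. [folklore] -/
theorem speed_const (q : ℍ) {a : ℝ} (ha : 0 ≤ a) : ∃ D : ℍ, HasDerivAt (fun _ : ℝ => q) D s ∧ ‖D‖ ≤ a := ⟨0, hasDerivAt_const s q, by simpa using ha⟩

omit [NeZero L] in
/-- The letter of a slice-`0` link (`C_ν` or `1`) has speed `≤ 1`. [folklore] -/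
theorem speed_letter (hC : ∀ μ, ∃ D : ℍ, HasDerivAt (fun s => su2Quat (C s μ)) D s ∧ ‖D‖ ≤ 1) (i : OffIdx L) :
    ∃ D : ℍ, HasDerivAt (fun s => su2Quat (letter (fun μ => C s (Fin.castSucc μ)) i)) D s ∧ ‖D‖ ≤ 1 := by
  by_cases h : i.1.1 i.1.2 = -1
  · simp only [letter, h, if_true]; exact hC _
  · simp only [letter, h, if_false, su2Quat_one]; exact speed_const 1 zero_le_one

/-- ★ A slice-`0` link has speed `≤ 2`. [folklore] -/
theorem speed_ringConfig_fst (χ : Site 3 L → SU2) (hC : ∀ μ, ∃ D : ℍ, HasDerivAt (fun s => su2Quat (C s μ)) D s ∧ ‖D‖ ≤ 1)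
    (hU : ∀ i, ∃ D : ℍ, HasDerivAt (fun s => su2Quat (U s i)) D s ∧ ‖D‖ ≤ 1) (i : OffIdx L) :
    ∃ D : ℍ, HasDerivAt (fun s => su2Quat ((ringConfig χ (C s, U s)).1 i)) D s ∧ ‖D‖ ≤ 2 := by
  by_cases h : isLead i = true
  · simp only [ringConfig_fst_of_isLead χ _ h]
    obtain ⟨D, hD, hle⟩ := hC (Fin.castSucc i.1.2)
    exact ⟨D, hD, hle.trans (by norm_num)⟩
  · have e : (fun s => su2Quat ((ringConfig χ (C s, U s)).1 i)) =
        fun s => su2Quat (letter (fun μ => C s (Fin.castSucc μ)) i) * su2Quat (U s (Sum.inl ⟨i, h⟩)) := by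
      funext s; rw [← su2Quat_mul]; exact congrArg su2Quat (ringConfig_fst_of_not_isLead χ (C s, U s) ⟨i, h⟩)
    rw [e]
    have h2 := exists_hasDerivAt_mul_norm_le (speed_letter hC i) (hU (Sum.inl ⟨i, h⟩)) (norm_su2Quat _).le (norm_su2Quat _).le
    obtain ⟨D, hD, hle⟩ := h2
    exact ⟨D, hD, hle.trans (by norm_num)⟩

/-- ★ A glued slice-`0` link has speed `≤ 2`. [folklore] -/
theorem speed_glue_ringConfig (χ : Site 3 L → SU2) (hC : ∀ μ, ∃ D : ℍ, HasDerivAt (fun s => su2Quat (C s μ)) D s ∧ ‖D‖ ≤ 1)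
    (hU : ∀ i, ∃ D : ℍ, HasDerivAt (fun s => su2Quat (U s i)) D s ∧ ‖D‖ ≤ 1) (e : Edge 3 L) :
    ∃ D : ℍ, HasDerivAt (fun s => su2Quat (glue (ringConfig χ (C s, U s)).1 e)) D s ∧ ‖D‖ ≤ 2 := by
  by_cases h : treeEdge e = true
  · simp only [su2Quat_glue, h, dif_pos]; exact speed_const 1 (by norm_num)
  · simp only [su2Quat_glue, h]
    exact speed_ringConfig_fst χ hC hU ⟨e, h⟩

/-- ★ A slice-`j` link (`j ≥ 1`) has speed `≤ 3`. [folklore] -/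
theorem speed_ringConfig_snd_fst (χ : Site 3 L → SU2) (hC : ∀ μ, ∃ D : ℍ, HasDerivAt (fun s => su2Quat (C s μ)) D s ∧ ‖D‖ ≤ 1)
    (hU : ∀ i, ∃ D : ℍ, HasDerivAt (fun s => su2Quat (U s i)) D s ∧ ‖D‖ ≤ 1) (j : Fin (2 * L - 1)) (e : Edge 3 L) :
    ∃ D : ℍ, HasDerivAt (fun s => su2Quat ((ringConfig χ (C s, U s)).2.1 j e)) D s ∧ ‖D‖ ≤ 3 := by
  have e' : (fun s => su2Quat ((ringConfig χ (C s, U s)).2.1 j e)) =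
      fun s => su2Quat (glue (ringConfig χ (C s, U s)).1 e) * su2Quat (U s (Sum.inr (Sum.inl (j, e)))) := by
    funext s; rw [ringConfig_snd_fst, su2Quat_mul]
  rw [e']
  have h := exists_hasDerivAt_mul_norm_le (speed_glue_ringConfig χ hC hU e) (hU (Sum.inr (Sum.inl (j, e)))) (norm_su2Quat _).le (norm_su2Quat _).le
  obtain ⟨D, hD, hle⟩ := h
  exact ⟨D, hD, hle.trans (by norm_num)⟩

/-- ★ A seam quaternion has speed `≤ 2`. [folklore] -/
theorem speed_ringConfig_snd_snd (χ : Site 3 L → SU2) (hC : ∀ μ, ∃ D : ℍ, HasDerivAt (fun s => su2Quat (C s μ)) D s ∧ ‖D‖ ≤ 1)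
    (hU : ∀ i, ∃ D : ℍ, HasDerivAt (fun s => su2Quat (U s i)) D s ∧ ‖D‖ ≤ 1) (x : Site 3 L) :
    ∃ D : ℍ, HasDerivAt (fun s => su2Quat ((ringConfig χ (C s, U s)).2.2 x)) D s ∧ ‖D‖ ≤ 2 := by
  by_cases h : x = 0
  · subst h
    simp only [ringConfig_snd_snd_zero]
    obtain ⟨D, hD, hle⟩ := hC (Fin.last 3)
    exact ⟨D, hD, hle.trans (by norm_num)⟩
  · have e : (fun s => su2Quat ((ringConfig χ (C s, U s)).2.2 x)) =
        fun s => su2Quat (χ x) * su2Quat (C s (Fin.last 3)) * su2Quat (U s (Sum.inr (Sum.inr ⟨x, h⟩))) := by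
      funext s; rw [← su2Quat_mul, ← su2Quat_mul]; exact congrArg su2Quat (ringConfig_snd_snd_of_ne χ (C s, U s) ⟨x, h⟩)
    rw [e]
    have h1 := exists_hasDerivAt_mul_norm_le (speed_const (s := s) (su2Quat (χ x)) le_rfl) (hC (Fin.last 3)) (norm_su2Quat _).le (norm_su2Quat _).le
    have h2 := exists_hasDerivAt_mul_norm_le h1 (hU (Sum.inr (Sum.inr ⟨x, h⟩)))
      ((norm_mul_le _ _).trans (by rw [norm_su2Quat, norm_su2Quat, one_mul])) (norm_su2Quat _).le
    obtain ⟨D, hD, hle⟩ := h2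
    exact ⟨D, hD, by linarith⟩

/-- ★★ **EVERY LINK ∕ SITE QUATERNION OF THE REBUILT RING HAS SPEED `≤ 3`** when the leader and follower letters move at speed `≤ 1`. [folklore] -/
theorem speed_fixHistory (χ : Site 3 L → SU2) (hC : ∀ μ, ∃ D : ℍ, HasDerivAt (fun s => su2Quat (C s μ)) D s ∧ ‖D‖ ≤ 1)
    (hU : ∀ i, ∃ D : ℍ, HasDerivAt (fun s => su2Quat (U s i)) D s ∧ ‖D‖ ≤ 1) :
    (∀ (i : Fin (2 * L - 1 + 1)) (e : Edge 3 L),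
        ∃ D : ℍ, HasDerivAt (fun s => su2Quat ((fixHistory (ringConfig χ (C s, U s))).1 i e)) D s ∧ ‖D‖ ≤ 3) ∧
      ∀ x : Site 3 L, ∃ D : ℍ, HasDerivAt (fun s => su2Quat ((fixHistory (ringConfig χ (C s, U s))).2 x)) D s ∧ ‖D‖ ≤ 3 := by
  refine ⟨fun i e => ?_, fun x => ?_⟩
  · refine Fin.cases ?_ (fun j => ?_) i
    · simp only [fixHistory, Fin.cons_zero]
      obtain ⟨D, hD, hle⟩ := speed_glue_ringConfig χ hC hU e
      exact ⟨D, hD, hle.trans (by norm_num)⟩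
    · simp only [fixHistory, Fin.cons_succ]; exact speed_ringConfig_snd_fst χ hC hU j e
  · obtain ⟨D, hD, hle⟩ := speed_ringConfig_snd_snd χ hC hU x
    exact ⟨D, hD, hle.trans (by norm_num)⟩

end Words

/-! ## §2 Along the gnomonic blow-up: `C_L = 324·L⁴` -/

omit [NeZero L] in
/-- The follower letters of the gnomonic blow-up point, read through `su2Quat`: `su2Quat (quatToSU2 (gnoLetter ε (e^s • v)))`. [folklore] -/
theorem su2Quat_blowUpPoint_gnomonic_snd (a : ℍ) (ε : GnoSign L) (η : GnoCoord L) (s : ℝ) (i : Fol L) :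
    su2Quat ((blowUpPoint (L := L) (Real.exp s) (gnomonicPoint a ε η)).2 i) = su2Quat (quatToSU2 (gnoLetter (ε.2.2 i) (Real.exp s • η.2.2 i))) := by
  show su2Quat (quatToSU2 (ZeroModeSigma.dilateIm (Real.exp s) (gnoLetter (ε.2.2 i) (η.2.2 i)))) = _
  rw [dilateIm_gnoLetter]

/-- ★★★ **S-B: THE EULER DERIVATIVE OF THE σ-GLUED DEFICIT ALONG THE GNOMONIC BLOW-UP IS BOUNDED BY `324·L⁴`**: for hub `a ≠ 0`, signs `ε`, coordinates `η`,
sector `z`, character `χ` and every `s`,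
`∃ d, HasDerivAt (fun s => chartDeficit L z χ (blowUpPoint (e^s) (gnomonicPoint a ε η))) d s ∧ |d| ≤ 324·L⁴`
(leaders ✓`hasDerivAt_leader_speed_le` `≤ 1`, followers ✓`hasDerivAt_smulLetter` `≤ 1/2`, words `speed_fixHistory` `≤ 3`, ✓`hasDerivAt_qDeficit_le` at `M = 3`,
✓`swapRingDeficit_eq_qDeficit`). [cite: Luscher1983, §2] -/
theorem hasDerivAt_chartDeficit_gnomonic_le (z : Fin 3 → Bool) (χ : Site 3 L → SU2) {a : ℍ} (ha : a ≠ 0) (ε : GnoSign L) (η : GnoCoord L) (s : ℝ) :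
    ∃ d : ℝ, HasDerivAt (fun s : ℝ => chartDeficit L z χ (blowUpPoint (Real.exp s) (gnomonicPoint a ε η))) d s ∧ |d| ≤ 324 * (L : ℝ) ^ 4 := by
  -- the letters
  have hC : ∀ μ : Fin 4, ∃ D : ℍ, HasDerivAt (fun s : ℝ => su2Quat ((blowUpPoint (L := L) (Real.exp s) (gnomonicPoint a ε η)).1 μ)) D s ∧ ‖D‖ ≤ 1 :=
    fun μ => hasDerivAt_leader_speed_le ha ε.1.1 ε.1.2 ε.2.1 η.1.1 η.1.2 η.2.1 s μ
  have hU : ∀ i : Fol L, ∃ D : ℍ, HasDerivAt (fun s : ℝ => su2Quat ((blowUpPoint (L := L) (Real.exp s) (gnomonicPoint a ε η)).2 i)) D s ∧ ‖D‖ ≤ 1 := by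
    intro i
    obtain ⟨D, hD, hle⟩ := hasDerivAt_smulLetter (ε.2.2 i) (η.2.2 i) s
    refine ⟨D, ?_, hle.trans (by norm_num)⟩
    have e : (fun s : ℝ => su2Quat ((blowUpPoint (L := L) (Real.exp s) (gnomonicPoint a ε η)).2 i)) =
        fun s => su2Quat (quatToSU2 (gnoLetter (ε.2.2 i) (Real.exp s • η.2.2 i))) := funext fun s => su2Quat_blowUpPoint_gnomonic_snd a ε η s i
    rw [e]; exact hD
  -- the words and the deficit
  obtain ⟨h1, h2⟩ := speed_fixHistory (C := fun s => (blowUpPoint (L := L) (Real.exp s) (gnomonicPoint a ε η)).1)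
    (U := fun s => (blowUpPoint (L := L) (Real.exp s) (gnomonicPoint a ε η)).2) χ hC hU
  have h := hasDerivAt_qDeficit_le (L := L) z (s := s) (M := 3) (by norm_num)
    (Q := fun s => ((fun (i : Fin (2 * L - 1 + 1)) (e : Edge 3 L) =>
        su2Quat ((fixHistory (ringConfig χ (blowUpPoint (L := L) (Real.exp s) (gnomonicPoint a ε η)))).1 i e)),
      fun x : Site 3 L => su2Quat ((fixHistory (ringConfig χ (blowUpPoint (L := L) (Real.exp s) (gnomonicPoint a ε η)))).2 x)))
    (fun i e => h1 i e) (fun x => h2 x) (fun i e => (norm_su2Quat _).le) (fun x => (norm_su2Quat _).le)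
  obtain ⟨d, hd, hle⟩ := h
  refine ⟨d, ?_, hle.trans (by nlinarith [pow_nonneg (Nat.cast_nonneg L : (0:ℝ) ≤ L) 4])⟩
  have e : (fun s : ℝ => chartDeficit L z χ (blowUpPoint (Real.exp s) (gnomonicPoint a ε η))) = fun s => qDeficit z
      ((fun (i : Fin (2 * L - 1 + 1)) (e : Edge 3 L) => su2Quat ((fixHistory (ringConfig χ (blowUpPoint (L := L) (Real.exp s) (gnomonicPoint a ε η)))).1 i e)),
        fun x : Site 3 L => su2Quat ((fixHistory (ringConfig χ (blowUpPoint (L := L) (Real.exp s) (gnomonicPoint a ε η)))).2 x)) :=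
    funext fun s => swapRingDeficit_eq_qDeficit z _
  rw [e]; exact hd

end Summit.QuantumFields.YangMills.Theorems.SwapVirialDeficit.Gnomonic

end
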